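import Literature.NumberTheory.EllipticCurves.ComplexMultiplicationShaRubinHomDescentProofs
import Literature.NumberTheory.EllipticCurves.RationalIsogenyDegreesProofs
import Literature.NumberTheory.EllipticCurves.Isogeny
import Literature.NumberTheory.EllipticCurves.MordellWeilProofs
import Mathlib.Algebra.Module.ZMod
import Mathlib.Tactic.Module
import Mathlib.Tactic.FieldSimp
import Mathlib.Tactic.LinearCombination
import HarnessLib

/-!
# bsd.S28 (Rubin): `Ш_𝔭 = 0` for `𝔭 ∤ 𝒴` — the two CM inputs of the descent at an inert prime
(Rubin 1999, Cor. 5.5 / Cor. 5.20 and Lemma 6.1, with Prop. 5.4 replaced by counting)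

Sibling *proofs* file (theorems only: no definition, no named fact, no instance) for the named
fact `Literature.NumberTheory.EllipticCurves.Rubin1987_sha_torsionBy_eq_bot_cofinite`
(`ComplexMultiplicationShaRubinProofs.lean`; K. Rubin, Invent. Math. 89 (1987), **Thm. 6.6**).
The companion file `…RubinHomDescentProofs.lean` embeds `Sel^{(p)}(E/K)` into
`Hom(Gal(K̄/K(E[p])), E[p]; S)^{Gal(K(E[p])/K)}` (Rubin 1987 §1; Rubin 1999 Lemma 6.4 / Thm. 6.5)
**granted two inputs from the theory of complex multiplication**, displayed there as hypotheses:

1. `Gal(K(E[p])/K)` is abelian — K. Rubin, LNM 1716 (1999), **Cor. 5.5** / **Cor. 5.20**: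
   *"`E[𝔭ⁿ] ≅ 𝒪/𝔭ⁿ`"* (Prop. 5.4) and *"`Gal(K(E[𝔭ⁿ])/K) ↪ (𝒪/𝔭ⁿ)^×`"*, the action of `G_K`
   commuting with `𝒪 = End_K(E)`;
2. some `g₀ ∈ G_K` has `P ↦ g₀P - P` bijective on `E[p]` — the element of the non-trivial
   prime-to-`p` part used in **Lemma 6.1** (it acts as a root of unity `ζ ≠ 1` with `ζ - 1` a
   unit of `𝒪/𝔭`).

This file **proves both inputs for a rational prime `p` inert in `𝒪 = ℤ[φ]`** from data the
tree has: a `K`-rational endomorphism `φ ∈ End_K(E)` (`WeierstrassCurve.endRing`: geometric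
endomorphisms of `E(K̄)` commuting with `Γ_K`) satisfying `φ² - tφ + m = 0` with `x² - tx + m`
irreducible mod `p`, and `#E[p] = p²` (Silverman III.6.4(b), tree
`card_torsionPoints_eq_sq_holds` / `WeierstrassCurve.natCard_geomTorsion_eq_sq`). Then `𝔽_p[φ] = 𝒪/p𝒪 ≅ 𝔽_{p²}` is a field acting on the group
`E[p]` of order `p²`, so `E[p]` is a line over it — this replaces Prop. 5.4 (`E[𝔭] ≅ 𝒪/𝔭`, proved
in the lectures from degrees of isogenies) for inert `p` — and every additive map of `E[p]`
commuting with `φ`, in particular every `σ ∈ Γ_K`, is multiplication by an element `a + bφ` of that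
field (Cor. 5.5: the action is through a character into `(𝒪/p)^×`):

* `Rubin1987.eq_zero_of_smul_add_smul_φ_eq_zero` — `φ` has no eigenvector on `E[p]`: for `v ≠ 0`,
  `a v + b φv = 0 ⇒ a = b = 0`;
* `Rubin1987.exists_eq_smul_add_smul_of_comm` — every `𝔽_p`-linear `g` commuting with `φ` is
  `a + bφ` (`(a, b) ↦ a v + b φ v` is a bijection `𝔽_p² → E[p]` by counting, and `g - (a + bφ)`
  kills `v`, `φv`);
* `Rubin1987.bijective_sub_id_of_comm` — if moreover `g ≠ 1` then `g - 1 = c + bφ ≠ 0` is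
  invertible: `(c + bt - bφ)(c + bφ) = c² + cbt + b²m = b²·f(-c/b) ≠ 0` (the norm form of the
  field `𝔽_p[φ]`; this is "`ζ - 1` is a unit" of Lemma 6.1 without choosing `ζ`);
* `Rubin1987.smul_comm_of_mem_endRing`, `Rubin1987.exists_mem_torsionFixing_mul_eq`,
  `Rubin1987.bijective_smul_sub_of_not_mem_torsionFixing` — **the two CM inputs** for the tree's
  `E[p] = geomTorsion W p` and `Γ_{K(E[p])} = torsionFixing W p`: any two elements of `Γ_K` commute
  on `E[p]` (so `ab ≡ ba mod Γ_{K(E[p])}`), and every `g₀ ∉ Γ_{K(E[p])}` has `g₀ - 1` bijective on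
  `E[p]`;
* `Rubin1987.exists_selmerGroup_embedding_unramifiedHoms_of_mem_endRing`,
  `Rubin1987.sha_torsionBy_eq_zero_of_forall_unramifiedHoms_eq_zero_of_mem_endRing` — **the
  descent of `…RubinHomDescentProofs.lean` made unconditional for such `p`**: over a number
  field, for `p` inert in `ℤ[φ]` with `E[p] ⊄ E(K)`, `Sel^{(p)}(E/K)` embeds into
  `Hom(Γ_{K(E[p])}, E[p]; S)` with `Γ_K`-equivariant values (`S ⊇ {bad places} ∪ {v ∣ p}`), and
  `Ш(E/K)[p] = 0` as soon as the `Γ_K`-equivariant part of `Hom(Γ_{K(E[p])}, E[p]; S)` vanishes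
  (`#E[p] = p²` being the tree's `WeierstrassCurve.natCard_geomTorsion_eq_sq`).

* `Rubin1987.exists_not_mem_torsionFixing_of_not_dvd`,
  `Rubin1987.exists_forall_prime_not_dvd_exists_not_mem_torsionFixing` — **`E[p] ⊄ E(K)` for
  every prime `p ∤ #E(K)_tors`** (a `Γ_K`-fixed non-zero point of `E[p]` is `K`-rational by
  Galois descent, tree `fixedPoints_eq_range_map_holds`, of order `p` in the finite group
  `E(K)_tors`, tree `finite_torsion_point`), so the hypothesis `g₀ ∉ Γ_{K(E[p])}` above holds for
  all but finitely many `p`; `Rubin1987.exists_forall_prime_sha_torsionBy_eq_zero_of_mem_endRing` —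
  the resulting **cofinite** form: there is `N > 0` such that for every prime `p ∤ N` inert in
  `ℤ[φ]`, `Ш(E/K)[p] = 0` as soon as `Hom_{Γ_K}(Γ_{K(E[p])}, E[p]; S) = 0`
  (`S ⊇ {bad places} ∪ {v ∣ p}`) — the shape of Thm. 6.6 / Thm. A (b) ("for all `𝔭 ∤ 𝒴`"), with
  the vanishing left to Cor. 6.10 and its arithmetic inputs.

## Faithfulness notes

* Only primes `p` that stay prime in `ℤ[φ]` are covered (`x² - tx + m` irreducible mod `p`): for a
  split `p = 𝔭𝔭̄` the same conclusions need `#E[𝔭] = N𝔭` (Prop. 5.4 (i), degrees of the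
  endomorphisms `[α]`), which the tree does not have. In Rubin's setting (`E` defined over `K`,
  `End_K(E) = 𝒪_K = ℤ[φ]`) the hypothesis `φ ∈ End_K(E)` with `φ² - tφ + m = 0` is
  Silverman, *Advanced Topics*, II.2.2 (b); it is displayed, not assumed as a fact (D-0026).
* Nothing here uses that `E` has CM beyond the displayed endomorphism; no statement of the fact is
  changed; no definition, named fact or instance is introduced.

## References

* K. Rubin, *Elliptic curves with complex multiplication and the conjecture of Birch and
  Swinnerton-Dyer*, LNM 1716 (1999): §5 Prop. 5.4, Cor. 5.5, Cor. 5.20; §6.1 Lemma 6.1,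
  Lemma 6.2 (i). [Rubin1999]
* K. Rubin, *Tate–Shafarevich groups and L-functions of elliptic curves with complex
  multiplication*, Invent. Math. 89 (1987): §1 (the fields `K(E_𝔭)`, `G = Gal(K(E_𝔭)/K)`),
  Thm. 6.6. [Rubin1987Sha]
* J. H. Silverman, *The Arithmetic of Elliptic Curves*, 2nd ed. (2009), Cor. III.6.4 (b)
  (the hypothesis `#E[p] = p²`). [SilvermanAEC2009]
-/

noncomputable section

open scoped Classical
open WeierstrassCurve Field

universe u

namespace Literature.NumberTheory.EllipticCurves

namespace Rubin1987

/-! ### Linear algebra of a line over `𝔽_p[φ] ≅ 𝔽_{p²}` -/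

section InertScalars

variable {p : ℕ} [Fact p.Prime] {M : Type*} [AddCommGroup M] [Module (ZMod p) M]

/-- **`φ` has no eigenvector.** If `φ² = tφ - m` on the `𝔽_p`-space `M` and `x² - tx + m` has no
root in `𝔽_p`, then for `v ≠ 0` the vectors `v, φv` are independent: `a v + b φ v = 0 ⇒ a = b = 0`
(otherwise `φv = e v` and `(e² - te + m) v = 0`). [cite: Rubin1999, Lemma 6.1 (proof), Cor. 5.5] -/
theorem eq_zero_of_smul_add_smul_φ_eq_zero (φ : M →ₗ[ZMod p] M) {t m : ZMod p}
    (hrel : ∀ x, φ (φ x) = t • φ x - m • x) (hirr : ∀ a : ZMod p, a * a - t * a + m ≠ 0)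
    {v : M} (hv : v ≠ 0) {a b : ZMod p} (h : a • v + b • φ v = 0) : a = 0 ∧ b = 0 := by
  by_cases hb : b = 0
  · subst hb
    rw [zero_smul, add_zero] at h
    refine ⟨by_contra fun ha ↦ hv ?_, rfl⟩
    rw [← inv_smul_smul₀ ha v, h, smul_zero]
  · exfalso
    set e : ZMod p := -(b⁻¹ * a) with he
    have hbφ : b • φ v = -(a • v) := eq_neg_of_add_eq_zero_right h
    have hφv : φ v = e • v := by
      rw [← inv_smul_smul₀ hb (φ v), hbφ, smul_neg, smul_smul, ← neg_smul]
    have h1 : φ (φ v) = (e * e) • v := by rw [hφv, map_smul, hφv, smul_smul]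
    have h2 : φ (φ v) = (t * e - m) • v := by rw [hrel, hφv, smul_smul, sub_smul]
    have h3 : (e * e - t * e + m) • v = 0 := by
      have h12 : (e * e) • v - (t * e - m) • v = 0 := by rw [← h1, ← h2, sub_self]
      rw [← sub_smul] at h12
      convert h12 using 2
      ring
    exact hv (by rw [← inv_smul_smul₀ (hirr e) v, h3, smul_zero])

/-- **Every endomorphism commuting with `φ` is `a + bφ`** (`M` of order `p²`): `E[p]` is a line
over the field `𝔽_p[φ]`, and its `𝔽_p[φ]`-endomorphisms are the scalars. Counting replaces
Prop. 5.4: `(a, b) ↦ a v + b φv` is injective `𝔽_p² → M` (no eigenvector), hence bijective, and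
`g - (a + bφ)` vanishes on `v`, on `φv = φ(v)`, hence everywhere.
[cite: Rubin1999, Prop. 5.4, Cor. 5.5] -/
theorem exists_eq_smul_add_smul_of_comm (hcard : Nat.card M = p ^ 2) (φ : M →ₗ[ZMod p] M)
    {t m : ZMod p} (hrel : ∀ x, φ (φ x) = t • φ x - m • x)
    (hirr : ∀ a : ZMod p, a * a - t * a + m ≠ 0) (g : M →ₗ[ZMod p] M)
    (hg : ∀ x, g (φ x) = φ (g x)) : ∃ a b : ZMod p, ∀ x, g x = a • x + b • φ x := by
  have hp : p.Prime := Fact.out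
  haveI : Finite M :=
    Nat.finite_of_card_ne_zero (by rw [hcard]; exact pow_ne_zero 2 hp.ne_zero)
  haveI : Nontrivial M :=
    Finite.one_lt_card_iff_nontrivial.1 (by rw [hcard]; exact Nat.one_lt_pow two_ne_zero hp.one_lt)
  obtain ⟨v, hv⟩ := exists_ne (0 : M)
  -- `(a, b) ↦ a v + b φ v` is a bijection `𝔽_p × 𝔽_p → M`
  let ψ : ZMod p × ZMod p → M := fun q ↦ q.1 • v + q.2 • φ v
  have hinj : Function.Injective ψ := by
    intro q q' hqq'
    have h0 : (q.1 - q'.1) • v + (q.2 - q'.2) • φ v = 0 := by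
      have h' : ψ q - ψ q' = 0 := sub_eq_zero.2 hqq'
      rw [← h', sub_smul, sub_smul]
      change _ = q.1 • v + q.2 • φ v - (q'.1 • v + q'.2 • φ v)
      abel
    obtain ⟨h1, h2⟩ := eq_zero_of_smul_add_smul_φ_eq_zero φ hrel hirr hv h0
    exact Prod.ext (sub_eq_zero.1 h1) (sub_eq_zero.1 h2)
  have hbij : Function.Bijective ψ :=
    hinj.bijective_of_nat_card_le (by rw [hcard, Nat.card_prod, Nat.card_zmod, pow_two])
  obtain ⟨⟨a, b⟩, hab⟩ := hbij.2 (g v)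
  refine ⟨a, b, fun x ↦ ?_⟩
  obtain ⟨⟨c, d⟩, rfl⟩ := hbij.2 x
  have hgv : g v = a • v + b • φ v := hab.symm
  have hgφv : g (φ v) = a • φ v + b • φ (φ v) := by rw [hg, hgv, map_add, map_smul, map_smul]
  change g (c • v + d • φ v) = a • (c • v + d • φ v) + b • φ (c • v + d • φ v)
  rw [map_add, map_smul, map_smul, hgv, hgφv, map_add, map_smul, map_smul]
  module

/-- **`g ≠ 1` commuting with `φ` has `g - 1` bijective** (`M` of order `p²`): `g - 1 = c + bφ`
with `(c, b) ≠ (0, 0)`, and `(c + bt - bφ)(c + bφ) = N` with `N = c² + cbt + b²m`, which is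
`c² ≠ 0` if `b = 0` and `b² f(-c/b) ≠ 0` (`f = x² - tx + m` rootless) otherwise; so `c + bφ` is
injective, hence bijective on the finite `M`. This is the unit `ζ - 1 ∈ (𝒪/𝔭)^×` of Rubin's
Lemma 6.1 for the element `g` of `Gal(K(E[𝔭])/K) ↪ (𝒪/𝔭)^×`.
[cite: Rubin1999, Lemma 6.1, Lemma 6.2 (i)] -/
theorem bijective_sub_id_of_comm (hcard : Nat.card M = p ^ 2) (φ : M →ₗ[ZMod p] M)
    {t m : ZMod p} (hrel : ∀ x, φ (φ x) = t • φ x - m • x)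
    (hirr : ∀ a : ZMod p, a * a - t * a + m ≠ 0) (g : M →ₗ[ZMod p] M)
    (hg : ∀ x, g (φ x) = φ (g x)) (hne : ∃ x, g x ≠ x) :
    Function.Bijective fun x ↦ g x - x := by
  have hp : p.Prime := Fact.out
  haveI : Finite M :=
    Nat.finite_of_card_ne_zero (by rw [hcard]; exact pow_ne_zero 2 hp.ne_zero)
  obtain ⟨a, b, hab⟩ := exists_eq_smul_add_smul_of_comm hcard φ hrel hirr g hg
  set c : ZMod p := a - 1 with hc
  have hgx : ∀ x, g x - x = c • x + b • φ x := fun x ↦ by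
    rw [hab, hc, sub_smul, one_smul]
    abel
  -- `(c, b) ≠ (0, 0)`
  have hcb : ¬ (c = 0 ∧ b = 0) := by
    rintro ⟨hc0, hb0⟩
    obtain ⟨x, hx⟩ := hne
    exact hx (sub_eq_zero.1 (by rw [hgx, hc0, hb0, zero_smul, zero_smul, add_zero]))
  -- the norm `N = c² + cbt + b²m ≠ 0`
  set N : ZMod p := c * c + c * b * t + b * b * m with hN
  have hN0 : N ≠ 0 := by
    by_cases hb : b = 0
    · have hc0 : c ≠ 0 := fun h ↦ hcb ⟨h, hb⟩
      rw [hN, hb, mul_zero, zero_mul, zero_mul, zero_mul, add_zero, add_zero]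
      exact mul_ne_zero hc0 hc0
    · have hq := hirr (-(c / b))
      have hfac : N = b * b * ((-(c / b)) * (-(c / b)) - t * (-(c / b)) + m) := by
        rw [hN]
        field_simp
        ring
      rw [hfac]
      exact mul_ne_zero (mul_ne_zero hb hb) hq
  -- `c + bφ` is injective: apply `c + bt - bφ`
  refine Finite.injective_iff_bijective.1 fun x y hxy ↦ ?_
  have hz : c • (x - y) + b • φ (x - y) = 0 := by
    have hxy' : g x - x = g y - y := hxy
    rw [← hgx, map_sub]
    calc g x - g y - (x - y) = (g x - x) - (g y - y) := by abel
      _ = 0 := by rw [hxy', sub_self]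
  have key : N • (x - y) =
      (c + b * t) • (c • (x - y) + b • φ (x - y)) - b • φ (c • (x - y) + b • φ (x - y)) := by
    rw [map_add, map_smul, map_smul, hrel, hN]
    module
  rw [hz, smul_zero, map_zero, smul_zero, sub_zero] at key
  exact sub_eq_zero.1 (by rw [← inv_smul_smul₀ hN0 (x - y), key, smul_zero])

end InertScalars

/-! ### Additive maps of a `p`-torsion group commuting with `φ` -/

section Additive

variable {p : ℕ} [Fact p.Prime] {M : Type*} [AddCommGroup M]

/-- **Two additive maps commuting with `φ` commute with each other** (`pM = 0`, `#M = p²`,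
`φ² = tφ - m`, `x² - tx + m` irreducible mod `p`): both are of the form `a + bφ`. For `M = E[p]`
and the Galois action this is the commutativity of `Gal(K(E[p])/K) ↪ (𝒪/p)^×`.
[cite: Rubin1999, Cor. 5.5, Cor. 5.20] -/
theorem comp_comm_of_comm_φ (hpM : ∀ x : M, p • x = 0) (hcard : Nat.card M = p ^ 2)
    (φ : M →+ M) {t m : ℤ} (hrel : ∀ x, φ (φ x) = t • φ x - m • x)
    (hirr : ∀ a : ZMod p, a * a - t * a + m ≠ 0) (g g' : M →+ M)
    (hg : ∀ x, g (φ x) = φ (g x)) (hg' : ∀ x, g' (φ x) = φ (g' x)) (x : M) :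
    g (g' x) = g' (g x) := by
  have inst : Module (ZMod p) M := AddCommGroup.zmodModule hpM
  let φₗ : M →ₗ[ZMod p] M := φ.toZModLinearMap p
  let gₗ : M →ₗ[ZMod p] M := g.toZModLinearMap p
  let g'ₗ : M →ₗ[ZMod p] M := g'.toZModLinearMap p
  have hrel' : ∀ x, φₗ (φₗ x) = (t : ZMod p) • φₗ x - (m : ZMod p) • x := fun x ↦ by
    change φ (φ x) = (t : ZMod p) • φ x - (m : ZMod p) • x
    rw [Int.cast_smul_eq_zsmul, Int.cast_smul_eq_zsmul]
    exact hrel x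
  obtain ⟨a, b, hab⟩ :=
    exists_eq_smul_add_smul_of_comm hcard φₗ hrel' hirr gₗ fun x ↦ hg x
  obtain ⟨a', b', hab'⟩ :=
    exists_eq_smul_add_smul_of_comm hcard φₗ hrel' hirr g'ₗ fun x ↦ hg' x
  change gₗ (g'ₗ x) = g'ₗ (gₗ x)
  simp only [map_add, map_smul, hab, hab', hrel']
  module

/-- **An additive map commuting with `φ` and different from the identity has `g - 1` bijective**
(hypotheses as in `comp_comm_of_comm_φ`). [cite: Rubin1999, Lemma 6.1, Lemma 6.2 (i)] -/
theorem bijective_sub_self_of_comm_φ (hpM : ∀ x : M, p • x = 0) (hcard : Nat.card M = p ^ 2)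
    (φ : M →+ M) {t m : ℤ} (hrel : ∀ x, φ (φ x) = t • φ x - m • x)
    (hirr : ∀ a : ZMod p, a * a - t * a + m ≠ 0) (g : M →+ M)
    (hg : ∀ x, g (φ x) = φ (g x)) (hne : ∃ x, g x ≠ x) :
    Function.Bijective fun x ↦ g x - x := by
  have inst : Module (ZMod p) M := AddCommGroup.zmodModule hpM
  let φₗ : M →ₗ[ZMod p] M := φ.toZModLinearMap p
  let gₗ : M →ₗ[ZMod p] M := g.toZModLinearMap p
  have hrel' : ∀ x, φₗ (φₗ x) = (t : ZMod p) • φₗ x - (m : ZMod p) • x := fun x ↦ by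
    change φ (φ x) = (t : ZMod p) • φ x - (m : ZMod p) • x
    rw [Int.cast_smul_eq_zsmul, Int.cast_smul_eq_zsmul]
    exact hrel x
  exact bijective_sub_id_of_comm hcard φₗ hrel' hirr gₗ (fun x ↦ hg x) hne

end Additive

/-! ### The two CM inputs for `E[p]` and `Γ_{K(E[p])}` -/

section Curve

variable {K : Type u} [Field K] (W : WeierstrassCurve K) {p : ℕ} [Fact p.Prime]

/-- **`Γ_K` acts on `E[p]` through a commutative quotient** when `E` has a `K`-rational
endomorphism `φ` (`φ ∈ End_K(E) = W.endRing`) with `φ² = tφ - m` and `x² - tx + m` irreducible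
mod `p`, and `#E[p] = p²`: any two `σ, τ ∈ Γ_K` commute on `E[p]` (each acts as some `a + bφ`).
Rubin 1999, Cor. 5.5 / Cor. 5.20 (`Gal(K(E[𝔭])/K) ↪ (𝒪/𝔭)^×`), for `p` inert in `ℤ[φ]`.
[cite: Rubin1999, Cor. 5.5, Cor. 5.20] [cite: Rubin1987Sha, §1] -/
theorem smul_comm_of_mem_endRing (hcard : Nat.card (geomTorsion W p) = p ^ 2)
    {φ : AddMonoid.End W.geomPoints} (hφ : φ ∈ W.endRing) {t m : ℤ}
    (hrel : ∀ P : W.geomPoints, φ (φ P) = t • φ P - m • P)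
    (hirr : ∀ a : ZMod p, a * a - t * a + m ≠ 0) (σ τ : absoluteGaloisGroup K)
    (P : geomTorsion W p) : σ • τ • P = τ • σ • P := by
  -- `φ` restricted to `E[p]`
  have hmem : ∀ Q : geomTorsion W p, φ Q ∈ geomTorsion W p := fun Q ↦ by
    rw [mem_geomTorsion_iff, ← map_zsmul, (mem_geomTorsion_iff W p _).1 Q.2, map_zero]
  let φM : geomTorsion W p →+ geomTorsion W p :=
    { toFun := fun Q ↦ ⟨φ Q, hmem Q⟩
      map_zero' := Subtype.ext (by simp)
      map_add' := fun Q Q' ↦ Subtype.ext (by simp) }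
  have hpM : ∀ Q : geomTorsion W p, p • Q = 0 := fun Q ↦
    Subtype.ext (by
      rw [AddSubgroupClass.coe_nsmul, ZeroMemClass.coe_zero, ← natCast_zsmul]
      exact (mem_geomTorsion_iff W p _).1 Q.2)
  have hrelM : ∀ Q : geomTorsion W p, φM (φM Q) = t • φM Q - m • Q := fun Q ↦
    Subtype.ext (by
      rw [AddSubgroupClass.coe_sub, AddSubgroupClass.coe_zsmul, AddSubgroupClass.coe_zsmul]
      exact hrel Q)
  have hequiv := (W.mem_equivariantSubring_iff φ).1 (Subring.mem_inf.1 hφ).2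
  have hcomm : ∀ (ρ : absoluteGaloisGroup K) (Q : geomTorsion W p),
      DistribSMul.toAddMonoidHom _ ρ (φM Q) = φM (DistribSMul.toAddMonoidHom _ ρ Q) :=
    fun ρ Q ↦ Subtype.ext (by
      rw [DistribSMul.toAddMonoidHom_apply, DistribSMul.toAddMonoidHom_apply,
        AddSubgroup.torsionBy.coe_smul]
      change ρ • φ Q = φ ((ρ • Q : geomTorsion W p) : W.geomPoints)
      rw [AddSubgroup.torsionBy.coe_smul, hequiv])
  have h := comp_comm_of_comm_φ hpM hcard φM hrelM hirr (DistribSMul.toAddMonoidHom _ σ)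
    (DistribSMul.toAddMonoidHom _ τ) (hcomm σ) (hcomm τ) P
  simpa only [DistribSMul.toAddMonoidHom_apply] using h

/-- **CM input (1): `Gal(K(E[p])/K)` is abelian** — for all `a, b ∈ Γ_K` there is
`c ∈ Γ_{K(E[p])}` with `ab = ba·c` (namely the commutator `a⁻¹b⁻¹ab`, which acts trivially on
`E[p]` by `smul_comm_of_mem_endRing`). Hypotheses as there (`p` inert in `ℤ[φ]`).
[cite: Rubin1999, Cor. 5.5, Cor. 5.20] [cite: Rubin1987Sha, §1] -/
theorem exists_mem_torsionFixing_mul_eq (hcard : Nat.card (geomTorsion W p) = p ^ 2)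
    {φ : AddMonoid.End W.geomPoints} (hφ : φ ∈ W.endRing) {t m : ℤ}
    (hrel : ∀ P : W.geomPoints, φ (φ P) = t • φ P - m • P)
    (hirr : ∀ a : ZMod p, a * a - t * a + m ≠ 0) (a b : absoluteGaloisGroup K) :
    ∃ c ∈ torsionFixing W p, a * b = b * a * c := by
  refine ⟨a⁻¹ * b⁻¹ * a * b, (mem_torsionFixing_iff W p).2 fun P ↦ ?_, by group⟩
  rw [mul_smul, mul_smul, mul_smul, smul_comm_of_mem_endRing W hcard hφ hrel hirr a b P,
    inv_smul_smul, inv_smul_smul]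

/-- **CM input (2): every `g₀ ∉ Γ_{K(E[p])}` has `P ↦ g₀P - P` bijective on `E[p]`** (`p` inert in
`ℤ[φ]`, hypotheses as in `smul_comm_of_mem_endRing`): `g₀` acts as `a + bφ ≠ 1`, and
`a - 1 + bφ` is a unit of the field `𝔽_p[φ]`. This is the element of Lemma 6.1 (there chosen in
the prime-to-`p` part) feeding Lemma 6.2 (i). [cite: Rubin1999, Lemma 6.1, Lemma 6.2 (i)] -/
theorem bijective_smul_sub_of_not_mem_torsionFixing
    (hcard : Nat.card (geomTorsion W p) = p ^ 2)
    {φ : AddMonoid.End W.geomPoints} (hφ : φ ∈ W.endRing) {t m : ℤ}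
    (hrel : ∀ P : W.geomPoints, φ (φ P) = t • φ P - m • P)
    (hirr : ∀ a : ZMod p, a * a - t * a + m ≠ 0) {g₀ : absoluteGaloisGroup K}
    (hg₀ : g₀ ∉ torsionFixing W p) :
    Function.Bijective fun P : geomTorsion W p ↦ g₀ • P - P := by
  have hmem : ∀ Q : geomTorsion W p, φ Q ∈ geomTorsion W p := fun Q ↦ by
    rw [mem_geomTorsion_iff, ← map_zsmul, (mem_geomTorsion_iff W p _).1 Q.2, map_zero]
  let φM : geomTorsion W p →+ geomTorsion W p :=
    { toFun := fun Q ↦ ⟨φ Q, hmem Q⟩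
      map_zero' := Subtype.ext (by simp)
      map_add' := fun Q Q' ↦ Subtype.ext (by simp) }
  have hpM : ∀ Q : geomTorsion W p, p • Q = 0 := fun Q ↦
    Subtype.ext (by
      rw [AddSubgroupClass.coe_nsmul, ZeroMemClass.coe_zero, ← natCast_zsmul]
      exact (mem_geomTorsion_iff W p _).1 Q.2)
  have hrelM : ∀ Q : geomTorsion W p, φM (φM Q) = t • φM Q - m • Q := fun Q ↦
    Subtype.ext (by
      rw [AddSubgroupClass.coe_sub, AddSubgroupClass.coe_zsmul, AddSubgroupClass.coe_zsmul]
      exact hrel Q)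
  have hequiv := (W.mem_equivariantSubring_iff φ).1 (Subring.mem_inf.1 hφ).2
  have hcomm : ∀ Q : geomTorsion W p,
      DistribSMul.toAddMonoidHom _ g₀ (φM Q) = φM (DistribSMul.toAddMonoidHom _ g₀ Q) :=
    fun Q ↦ Subtype.ext (by
      rw [DistribSMul.toAddMonoidHom_apply, DistribSMul.toAddMonoidHom_apply,
        AddSubgroup.torsionBy.coe_smul]
      change g₀ • φ Q = φ ((g₀ • Q : geomTorsion W p) : W.geomPoints)
      rw [AddSubgroup.torsionBy.coe_smul, hequiv])
  have hne : ∃ Q : geomTorsion W p, DistribSMul.toAddMonoidHom _ g₀ Q ≠ Q :=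
    not_forall.1 (mt (mem_torsionFixing_iff W p).2 hg₀)
  have h := bijective_sub_self_of_comm_φ hpM hcard φM hrelM hirr
    (DistribSMul.toAddMonoidHom _ g₀) hcomm hne
  simpa only [DistribSMul.toAddMonoidHom_apply] using h

end Curve

/-! ### The descent made unconditional at an inert prime -/

section Assembly

open NumberField IsDedekindDomain

variable {K : Type u} [Field K] [NumberField K] (W : WeierstrassCurve K) {p : ℕ} [Fact p.Prime]

/-- **Rubin 1999 Thm. 6.5 "⊆" / Rubin 1987 §1, unconditionally at an inert prime.** Let `E/K`
be an elliptic curve over a number field with a `K`-rational endomorphism `φ` (`φ ∈ End_K(E)`),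
`φ² = tφ - m`, let `p` be a prime with `x² - tx + m` irreducible mod `p` (i.e. `p` inert in
`ℤ[φ]`) and `E[p] ⊄ E(K)` (some `g₀ ∈ Γ_K` moves a `p`-torsion point), and let
`S ⊇ {bad places} ∪ {v ∣ p}`. Then `x ↦ (ρ ↦ [x, ρ])` is an injective map
`Sel^{(p)}(E/K) → Hom(Γ_{K(E[p])}, E[p]; S)` with `Γ_K`-equivariant values — the embedding
`S(𝔭) ↪ Hom(Gal(K̄/K(E_𝔭)), E_𝔭)^G` (unramified outside `S`) with both CM inputs discharged
(`exists_mem_torsionFixing_mul_eq`, `bijective_smul_sub_of_not_mem_torsionFixing`).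
[cite: Rubin1999, Thm. 6.5, Lemma 6.2 (i), Cor. 5.20] [cite: Rubin1987Sha, §1] -/
theorem exists_selmerGroup_embedding_unramifiedHoms_of_mem_endRing [W.IsElliptic]
    {φ : AddMonoid.End W.geomPoints} (hφ : φ ∈ W.endRing) {t m : ℤ}
    (hrel : ∀ P : W.geomPoints, φ (φ P) = t • φ P - m • P)
    (hirr : ∀ a : ZMod p, a * a - t * a + m ≠ 0)
    {g₀ : absoluteGaloisGroup K} (hg₀ : g₀ ∉ torsionFixing W p)
    {S : Set (HeightOneSpectrum (𝓞 K))} (hbad : W.badPlaces (𝓞 K) ⊆ S)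
    (hdiv : ∀ v : HeightOneSpectrum (𝓞 K), (p : 𝓞 K) ∈ v.asIdeal → v ∈ S) :
    ∃ r : selmerGroup W p → unramifiedHoms (torsionFixing W p) (geomTorsion W p) S,
      Function.Injective r ∧
      (∀ (x : selmerGroup W p) (u : torsionFixing W p), (r x).1 u = h1Eval W p x u) ∧
      ∀ (x : selmerGroup W p) (σ : absoluteGaloisGroup K) (u : torsionFixing W p),
        (r x).1 ⟨σ * u * σ⁻¹, (torsionFixing_normal W p).conj_mem _ u.2 σ⟩ = σ • (r x).1 u := by
  have hp : p.Prime := Fact.out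
  have hcard : Nat.card (geomTorsion W p) = p ^ 2 :=
    W.natCard_geomTorsion_eq_sq (Nat.cast_ne_zero.2 hp.ne_zero)
  exact exists_selmerGroup_embedding_unramifiedHoms W p (Nat.cast_ne_zero.2 hp.ne_zero)
    (exists_mem_torsionFixing_mul_eq W hcard hφ hrel hirr)
    (bijective_smul_sub_of_not_mem_torsionFixing W hcard hφ hrel hirr hg₀) hbad
    (fun v hv ↦ hdiv v (by rwa [Int.cast_natCast] at hv))

/-- **`Ш(E/K)[p] = 0` from the vanishing of `Hom_{Γ_K}(Γ_{K(E[p])}, E[p]; S)`, unconditionally at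
an inert prime** (hypotheses as in `exists_selmerGroup_embedding_unramifiedHoms_of_mem_endRing`):
if every `Γ_K`-equivariant continuous homomorphism `Γ_{K(E[p])} → E[p]` unramified outside `S`
vanishes, then `Sel^{(p)}(E/K) = 0` and `Ш(E/K)[p] = 0`. In Rubin's proof of Thm. 6.6 the
vanishing is supplied, for the finer group of Thm. 6.9, by Cor. 6.10 (`…RubinCriterionProofs`).
[cite: Rubin1987Sha, Thm. 6.6, (1.2)] [cite: Rubin1999, Thm. 6.5, Cor. 6.10, Remark 10.11] -/
theorem sha_torsionBy_eq_zero_of_forall_unramifiedHoms_eq_zero_of_mem_endRing [W.IsElliptic]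
    {φ : AddMonoid.End W.geomPoints} (hφ : φ ∈ W.endRing) {t m : ℤ}
    (hrel : ∀ P : W.geomPoints, φ (φ P) = t • φ P - m • P)
    (hirr : ∀ a : ZMod p, a * a - t * a + m ≠ 0)
    {g₀ : absoluteGaloisGroup K} (hg₀ : g₀ ∉ torsionFixing W p)
    {S : Set (HeightOneSpectrum (𝓞 K))} (hbad : W.badPlaces (𝓞 K) ⊆ S)
    (hdiv : ∀ v : HeightOneSpectrum (𝓞 K), (p : 𝓞 K) ∈ v.asIdeal → v ∈ S)
    (hHom : ∀ f ∈ unramifiedHoms (torsionFixing W p) (geomTorsion W p) S,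
      (∀ (σ : absoluteGaloisGroup K) (u : torsionFixing W p),
        f ⟨σ * u * σ⁻¹, (torsionFixing_normal W p).conj_mem _ u.2 σ⟩ = σ • f u) → f = 0)
    (c : W.sha) (hc : p • c = 0) : c = 0 := by
  have hp : p.Prime := Fact.out
  have hn : ((p : ℕ) : ℤ) ≠ 0 := Nat.cast_ne_zero.2 hp.ne_zero
  have hcard : Nat.card (geomTorsion W p) = p ^ 2 :=
    W.natCard_geomTorsion_eq_sq (Nat.cast_ne_zero.2 hp.ne_zero)
  have hres : subgroupResKer (geomTorsion W p) (torsionFixing W p) = ⊥ :=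
    subgroupResKer_torsionFixing_eq_bot W p (isOpen_torsionFixing W hn)
      (exists_mem_torsionFixing_mul_eq W hcard hφ hrel hirr)
      (bijective_smul_sub_of_not_mem_torsionFixing W hcard hφ hrel hirr hg₀)
  exact sha_torsionBy_eq_zero_of_forall_unramifiedHoms_eq_zero W p hn hres hbad
    (fun v hv ↦ hdiv v (by rwa [Int.cast_natCast] at hv)) hHom c (by rw [natCast_zsmul]; exact hc)

end Assembly

/-! ### `E[p] ⊄ E(K)` for almost all `p`, and the cofinite form -/

section Rational

open NumberField IsDedekindDomain

variable {K : Type u} [Field K] [NumberField K] (W : WeierstrassCurve K)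

/-- **`E[p] ⊄ E(K)` for `p ∤ #E(K)_tors`.** For an elliptic curve over a number field and a prime
`p` not dividing the order of the (finite, tree `finite_torsion_point`) torsion subgroup of
`E(K)`, some `g₀ ∈ Γ_K` moves a point of `E[p]`: otherwise a non-zero `P ∈ E[p]` (`#E[p] = p²`)
is `Γ_K`-fixed, hence `K`-rational (Galois descent, tree `fixedPoints_eq_range_map_holds`), of
order `p` in `E(K)_tors`. (The points are those of `W.baseChange K`, the curve regarded over
`K`, as in the descent statement.) [folklore] [cite: SilvermanAEC2009, VIII.§1 (proof of Prop. 1.2), Cor. III.6.4 (b)] -/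
theorem exists_not_mem_torsionFixing_of_not_dvd [W.IsElliptic] {p : ℕ} (hp : p.Prime)
    (hpN : ¬ p ∣ Nat.card (AddCommGroup.torsion (W.baseChange K).toAffine.Point)) :
    ∃ g₀ : absoluteGaloisGroup K, g₀ ∉ torsionFixing W p := by
  haveI := Fact.mk hp
  by_contra hall
  push Not at hall
  -- a non-zero `p`-torsion point of `E(K̄)`
  have hcard : Nat.card (geomTorsion W p) = p ^ 2 :=
    W.natCard_geomTorsion_eq_sq (Nat.cast_ne_zero.2 hp.ne_zero)
  haveI : Finite (geomTorsion W p) :=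
    Nat.finite_of_card_ne_zero (by rw [hcard]; exact pow_ne_zero 2 hp.ne_zero)
  haveI : Nontrivial (geomTorsion W p) :=
    Finite.one_lt_card_iff_nontrivial.1 (by rw [hcard]; exact Nat.one_lt_pow two_ne_zero hp.one_lt)
  obtain ⟨P, hP⟩ := exists_ne (0 : geomTorsion W p)
  -- it is fixed by `Γ_K`, hence `K`-rational (Galois descent)
  have hfix : (P : W.geomPoints) ∈
      MulAction.fixedPoints (absoluteGaloisGroup K) W.geomPoints := by
    rw [MulAction.mem_fixedPoints]
    intro σ
    rw [← AddSubgroup.torsionBy.coe_smul, (mem_torsionFixing_iff W p).1 (hall σ) P]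
  rw [fixedPoints_eq_range_map_holds W] at hfix
  obtain ⟨Q, hQ⟩ := hfix
  simp only at hQ
  have hinj : Function.Injective
      (Affine.Point.baseChange K (AlgebraicClosure K) :
        (W.baseChange K).toAffine.Point → W.geomPoints) :=
    Affine.Point.map_injective _
  have hQ0 : Q ≠ 0 := by
    rintro rfl
    apply hP
    apply Subtype.ext
    rw [ZeroMemClass.coe_zero, ← hQ]
    exact map_zero _
  have hpQ : p • Q = 0 := by
    apply hinj
    rw [map_nsmul, map_zero, hQ, ← natCast_zsmul]
    exact (mem_geomTorsion_iff W p _).1 P.2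
  -- so `Q ∈ E(K)_tors` has order `p ∣ #E(K)_tors`
  have hord : addOrderOf Q = p := addOrderOf_eq_prime hpQ hQ0
  have hmem : Q ∈ AddCommGroup.torsion (W.baseChange K).toAffine.Point :=
    (AddCommGroup.mem_torsion Q).2 (isOfFinAddOrder_iff_nsmul_eq_zero.2 ⟨p, hp.pos, hpQ⟩)
  exact hpN (hord ▸ AddSubgroup.addOrderOf_dvd_natCard _ hmem)

/-- **`E[p] ⊄ E(K)` for all but finitely many `p`**: with `N = #E(K)_tors > 0`, every prime
`p ∤ N` has some `g₀ ∈ Γ_K` outside `Γ_{K(E[p])}`. [folklore]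
[cite: SilvermanAEC2009, Cor. VIII.6.7.1 (finiteness of `E(K)_tors`)] -/
theorem exists_forall_prime_not_dvd_exists_not_mem_torsionFixing [W.IsElliptic] :
    ∃ N : ℕ, 0 < N ∧ ∀ p : ℕ, p.Prime → ¬ p ∣ N →
      ∃ g₀ : absoluteGaloisGroup K, g₀ ∉ torsionFixing W p := by
  haveI : Finite (AddCommGroup.torsion (W.baseChange K).toAffine.Point) :=
    (W.baseChange K).finite_torsion_point
  exact ⟨_, Nat.card_pos, fun p hp hpN ↦ exists_not_mem_torsionFixing_of_not_dvd W hp hpN⟩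

/-- **Cofinite form (the shape of Rubin's Thm. 6.6 / Thm. A (b)).** Let `E/K` be an elliptic curve
over a number field with a `K`-rational endomorphism `φ`, `φ² = tφ - m`. There is `N > 0` such
that for every prime `p ∤ N` with `x² - tx + m` irreducible mod `p` (i.e. `p` inert in `ℤ[φ]`) and
every `S ⊇ {bad places} ∪ {v ∣ p}`: if every `Γ_K`-equivariant continuous homomorphism
`Γ_{K(E[p])} → E[p]` unramified outside `S` vanishes, then `Ш(E/K)[p] = 0`. (The vanishing is
what Cor. 6.10 — `…RubinCriterionProofs` — extracts, for the finer group of Thm. 6.9, from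
`A^{χ_E} = 0` (Thm. 10.8) and `δ(η) ≠ 0 ⇔ 𝔭 ∤ L(ψ̄,1)/Ω` (Prop. 10.6, Wiles' reciprocity); those
inputs, the class field theory, and the split primes remain outside the tree.)
[cite: Rubin1987Sha, Thm. 6.6, Thm. A (b), (1.2)] [cite: Rubin1999, Thm. 6.5, Cor. 6.10, Remark 10.11] -/
theorem exists_forall_prime_sha_torsionBy_eq_zero_of_mem_endRing [W.IsElliptic]
    {φ : AddMonoid.End W.geomPoints} (hφ : φ ∈ W.endRing) {t m : ℤ}
    (hrel : ∀ P : W.geomPoints, φ (φ P) = t • φ P - m • P) :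
    ∃ N : ℕ, 0 < N ∧ ∀ p : ℕ, p.Prime → ¬ p ∣ N → (∀ a : ZMod p, a * a - t * a + m ≠ 0) →
      ∀ {S : Set (HeightOneSpectrum (𝓞 K))}, W.badPlaces (𝓞 K) ⊆ S →
        (∀ v : HeightOneSpectrum (𝓞 K), (p : 𝓞 K) ∈ v.asIdeal → v ∈ S) →
        (∀ f ∈ unramifiedHoms (torsionFixing W p) (geomTorsion W p) S,
          (∀ (σ : absoluteGaloisGroup K) (u : torsionFixing W p),
            f ⟨σ * u * σ⁻¹, (torsionFixing_normal W p).conj_mem _ u.2 σ⟩ = σ • f u) → f = 0) →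
        ∀ c : W.sha, p • c = 0 → c = 0 := by
  obtain ⟨N, hN, hfix⟩ := exists_forall_prime_not_dvd_exists_not_mem_torsionFixing W
  refine ⟨N, hN, fun p hp hpN hirr S hbad hdiv hHom c hc ↦ ?_⟩
  haveI := Fact.mk hp
  obtain ⟨g₀, hg₀⟩ := hfix p hp hpN
  exact sha_torsionBy_eq_zero_of_forall_unramifiedHoms_eq_zero_of_mem_endRing W hφ hrel hirr hg₀
    hbad hdiv hHom c hc

end Rational

end Rubin1987

end Literature.NumberTheory.EllipticCurves

end
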